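import Literature.AlgebraicGeometry.HodgeTheory.HomComplex
import Mathlib.Algebra.Homology.BifunctorShift
import Mathlib.Algebra.Homology.HomotopyCategory.ShiftSequence
import HarnessLib

/-!
# The internal Hom complex and shifts: `𝓗om•(E•⟦m⟧, F•) ≅ 𝓗om•(E•, F•)⟦-m⟧`

For cochain complexes of `𝒪_X`-modules `E•`, `F•` on a scheme `X` and `m : ℤ` we construct the
canonical isomorphisms

* `dualComplexShiftIso X E m : (E⟦m⟧)ᵒ ≅ (Eᵒ)⟦-m⟧` — the dual indexing `dualComplex` of
  `HodgeTheory/HomComplex.lean` (`i ↦ op E^{-i}`, differential `(-1)^j d_Eᵒᵖ`) turns the shift `⟦m⟧`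
  into `⟦-m⟧`, with the sign `(-1)^{im}` in degree `i` (forced by the sign `(-1)^m` of the shifted
  differential);
* **`homComplexShiftIso X E F m : 𝓗om•(E⟦m⟧, F) ≅ 𝓗om•(E, F)⟦-m⟧`** — from the previous one and
  Mathlib's compatibility of `mapBifunctor` with the shift of its second variable
  (`CochainComplex.mapBifunctorShift₂Iso`, sign `(-1)^{p·(-m)}` on the summand of bidegree `(p, ·)`);
  naturality in `F` (`homComplexShiftIso_hom_naturality`);
* the dual complex `E•^∨ := 𝓗om•(E•, 𝒪_X[0])` of the road-2T files: **`dualComplexUnitShiftIso :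
  (E⟦m⟧)^∨ ≅ (E^∨)⟦-m⟧`**, in particular `(E⟦1⟧)^∨ ≅ E^∨⟦-1⟧` — the tree's shift∕sign convention for
  duals made explicit (Stacks, *More on Algebra*, Section «Sign rules», item (18) = Tag 0FNN: the
  identification `Hom•(M•, K•)[a-b] → Hom•(M•[b], K•[a])` «uses the sign `(-1)^{nb}` on the module
  `Hom(M^{-q}, K^p)` with `p + q = n`»; here `a = 0`, `b = m`, and the total sign of
  `homComplexShiftIso` on the summand of total degree `n` is indeed `(-1)^{nm}`).

Everything is proved; the definitions are constructions with bodies; no named facts, no instances.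
Use (Hodge programme, road №4, crux 26512, shelf item (β3) derived duality): memo-11 (P-β3-d) sanity
lemma; library only — proves nothing about 26512, №4, HC_AV or HC.

## References

* The Stacks Project, Tag 0FNN (More on Algebra, Section «Sign rules», item (18): Hom complexes
  and shifts), Tag 0FNG (the section). [StacksProject]
* C. Weibel, *An introduction to homological algebra* (1994), 1.2.8 (translates), 2.7.4–2.7.5. [Weibel1994]
-/

noncomputable section

open CategoryTheory CategoryTheory.Limits AlgebraicGeometry Opposite

universe u

namespace Literature.AlgebraicGeometry.HodgeTheory

open Literature.AlgebraicGeometry.Modules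

/-! ## §0 Plumbing: an isomorphism rescaled by a sign -/

section UnitsSmul

variable {C : Type*} [Category C] [Preadditive C] {A B : C}

/-- An isomorphism rescaled by a unit of `ℤ` (a sign). [folklore] -/
def unitsSmulIso (ε : ℤˣ) (e : A ≅ B) : A ≅ B where
  hom := ε • e.hom
  inv := ε⁻¹ • e.inv
  hom_inv_id := by
    rw [Linear.units_smul_comp, Linear.comp_units_smul, e.hom_inv_id, smul_smul, mul_inv_cancel,
      one_smul]
  inv_hom_id := by
    rw [Linear.units_smul_comp, Linear.comp_units_smul, e.inv_hom_id, smul_smul, inv_mul_cancel,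
      one_smul]

/-- Unfolding. [folklore] -/
@[simp]
private lemma unitsSmulIso_hom (ε : ℤˣ) (e : A ≅ B) : (unitsSmulIso ε e).hom = ε • e.hom := rfl

/-- Unfolding. [folklore] -/
@[simp]
private lemma unitsSmulIso_inv (ε : ℤˣ) (e : A ≅ B) : (unitsSmulIso ε e).inv = ε⁻¹ • e.inv := rfl

end UnitsSmul

variable (X : Scheme.{u})

/-! ## §1 The dual indexing and shifts: `(E⟦m⟧)ᵒ ≅ (Eᵒ)⟦-m⟧` -/

/-- **`(E⟦m⟧)ᵒ ≅ (Eᵒ)⟦-m⟧`** for the dual indexing `dualComplex` (`i ↦ op E^{-i}`, differential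
`(-1)^j d_Eᵒᵖ`): in degree `i` both sides are `op E^{m-i}`, and the isomorphism is `(-1)^{im}` times
the identity (the shifted differential carries `(-1)^{-m}`, the differential of `E⟦m⟧` carries
`(-1)^m`). [cite: StacksProject, Tag 0FNN (More on Algebra, Sign rules (18))] -/
def dualComplexShiftIso (E : CochainComplex X.Modules ℤ) (m : ℤ) :
    dualComplex X (E⟦m⟧) ≅ (dualComplex X E)⟦-m⟧ :=
  HomologicalComplex.Hom.isoOfComponents
    (fun i => unitsSmulIso (i * m).negOnePow
      (E.XIsoOfEq (show -(i + -m) = -i + m by lia)).op)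
    (fun i j hij => by
      have hij' : i + 1 = j := hij
      subst hij'
      apply Quiver.Hom.unop_inj
      change (((-m).negOnePow : ℤˣ) • (((i + 1 + -m).negOnePow : ℤˣ) •
            E.d (-(i + 1 + -m)) (-(i + -m)))) ≫
          (((i * m).negOnePow : ℤˣ) • (E.XIsoOfEq (show -(i + -m) = -i + m by lia)).hom) =
        ((((i + 1) * m).negOnePow : ℤˣ) •
            (E.XIsoOfEq (show -(i + 1 + -m) = -(i + 1) + m by lia)).hom) ≫
          (((i + 1).negOnePow : ℤˣ) • ((m.negOnePow : ℤˣ) • E.d (-(i + 1) + m) (-i + m)))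
      simp only [Linear.units_smul_comp, Linear.comp_units_smul, smul_smul,
        HomologicalComplex.d_comp_XIsoOfEq_hom, HomologicalComplex.XIsoOfEq_hom_comp_d]
      congr 1
      simp only [← Int.negOnePow_add]
      rw [Int.negOnePow_eq_iff]
      exact ⟨-(2 * m), by ring⟩)

/-- Components of `dualComplexShiftIso`: `(-1)^{im}` times the identity of `op E^{m-i}`.
[cite: StacksProject, Tag 0FNN (More on Algebra, Sign rules (18))] -/
lemma dualComplexShiftIso_hom_f (E : CochainComplex X.Modules ℤ) (m i : ℤ) :
    (dualComplexShiftIso X E m).hom.f i =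
      ((i * m).negOnePow : ℤˣ) • ((E.XIsoOfEq (show -(i + -m) = -i + m by lia)).hom).op :=
  rfl

/-! ## §2 `𝓗om•(E⟦m⟧, F) ≅ 𝓗om•(E, F)⟦-m⟧`, natural in `F` -/

section HomComplexShift

variable (E : CochainComplex X.Modules ℤ)

/-- **`𝓗om•(E•⟦m⟧, F•) ≅ 𝓗om•(E•, F•)⟦-m⟧`**: transport of `dualComplexShiftIso` through the
bifunctor `mapBifunctor F (–) 𝓗om.flip`, followed by Mathlib's compatibility of `mapBifunctor` with
the shift of its second variable (`CochainComplex.mapBifunctorShift₂Iso`, sign `(-1)^{p·(-m)}` on the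
summand of bidegree `(p, ·)`). Total sign on `𝓗om(E^{m-i}, F^q) ⊆ 𝓗om•(E⟦m⟧, F)^{n}`, `n = q + i`:
`(-1)^{im} · (-1)^{-qm} = (-1)^{nm}`, Stacks' `(-1)^{nb}` (Tag 0FNN with `a = 0`, `b = m`). [cite: StacksProject, Tag 0FNN (More on Algebra, Sign rules (18))] -/
def homComplexShiftIso (F : CochainComplex X.Modules ℤ) (m : ℤ) :
    homComplex X (E⟦m⟧) F ≅ (homComplex X E F)⟦-m⟧ :=
  (((sheafHomBifunctor X).flip.map₂CochainComplex).obj F).mapIso (dualComplexShiftIso X E m) ≪≫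
    CochainComplex.mapBifunctorShift₂Iso F (dualComplex X E) (sheafHomBifunctor X).flip (-m)

/-- **Naturality of `homComplexShiftIso` in `F•`**: for `φ : F ⟶ F'`,
`𝓗om•(E⟦m⟧, φ) ≫ θ_{F'} = θ_F ≫ 𝓗om•(E, φ)⟦-m⟧`. [cite: StacksProject, Tag 0FNN (More on Algebra, Sign rules (18))] -/
theorem homComplexShiftIso_hom_naturality {F F' : CochainComplex X.Modules ℤ} (φ : F ⟶ F') (m : ℤ) :
    HomComplex.map X (E⟦m⟧) φ ≫ (homComplexShiftIso X E F' m).hom =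
      (homComplexShiftIso X E F m).hom ≫ (HomComplex.map X E φ)⟦(-m : ℤ)⟧' := by
  have sq1 := (((sheafHomBifunctor X).flip.map₂CochainComplex).map φ).naturality
    (dualComplexShiftIso X E m).hom
  have sq2 := NatTrans.shift_app_comm (((sheafHomBifunctor X).flip.map₂CochainComplex).map φ) (-m)
    (dualComplex X E)
  rw [Functor.commShiftIso_map₂CochainComplex_hom_app, Functor.commShiftIso_map₂CochainComplex_hom_app] at sq2
  change _ ≫ ((((sheafHomBifunctor X).flip.map₂CochainComplex).obj F').map (dualComplexShiftIso X E m).hom ≫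
      (CochainComplex.mapBifunctorShift₂Iso F' (dualComplex X E) (sheafHomBifunctor X).flip (-m)).hom) =
    ((((sheafHomBifunctor X).flip.map₂CochainComplex).obj F).map (dualComplexShiftIso X E m).hom ≫
      (CochainComplex.mapBifunctorShift₂Iso F (dualComplex X E) (sheafHomBifunctor X).flip (-m)).hom) ≫ _
  rw [← Category.assoc]
  erw [← sq1]
  rw [Category.assoc]
  erw [← sq2]
  rw [Category.assoc]
  rfl

/-- `QuasiIso` transfers along `homComplexShiftIso`: `𝓗om•(E⟦m⟧, φ)` is a quasi-isomorphism iff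
`𝓗om•(E, φ)` is. [cite: StacksProject, Tag 0FNN (More on Algebra, Sign rules (18))] -/
theorem quasiIso_map_shift_iff {F F' : CochainComplex X.Modules ℤ} (φ : F ⟶ F') (m : ℤ) :
    QuasiIso (HomComplex.map X (E⟦m⟧) φ) ↔ QuasiIso (HomComplex.map X E φ) := by
  have h : HomComplex.map X (E⟦m⟧) φ =
      (homComplexShiftIso X E F m).hom ≫ (HomComplex.map X E φ)⟦(-m : ℤ)⟧' ≫
        (homComplexShiftIso X E F' m).inv := by
    rw [← Category.assoc, ← homComplexShiftIso_hom_naturality, Category.assoc, Iso.hom_inv_id,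
      Category.comp_id]
  rw [h, quasiIso_iff_comp_left, quasiIso_iff_comp_right]
  exact CochainComplex.quasiIso_shift_iff _ _

end HomComplexShift

/-! ## §3 Duals: `(E⟦m⟧)^∨ ≅ (E^∨)⟦-m⟧`, `E•^∨ := 𝓗om•(E•, 𝒪_X[0])` -/

/-- **`(E•⟦m⟧)^∨ ≅ (E•^∨)⟦-m⟧`** for the dual complex `E•^∨ := 𝓗om•(E•, 𝒪_X[0])` of the road-2T
files (`HodgeTheory/HomComplexPullbackIso`): the tree's shift∕sign convention for duals; in particular
`(E⟦1⟧)^∨ ≅ E^∨⟦-1⟧`. [cite: StacksProject, Tag 0FNN (More on Algebra, Sign rules (18))] -/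
def dualComplexUnitShiftIso (E : CochainComplex X.Modules ℤ) (m : ℤ) :
    homComplex X (E⟦m⟧) ((HomologicalComplex.single X.Modules (ComplexShape.up ℤ) 0).obj (unitModule X)) ≅
      (homComplex X E ((HomologicalComplex.single X.Modules (ComplexShape.up ℤ) 0).obj (unitModule X)))⟦-m⟧ :=
  homComplexShiftIso X E _ m

/-- The case `m = 1`: `(E⟦1⟧)^∨ ≅ E^∨⟦-1⟧`. [cite: StacksProject, Tag 0FNN (More on Algebra, Sign rules (18))] -/
def dualComplexUnitShiftOneIso (E : CochainComplex X.Modules ℤ) :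
    homComplex X (E⟦(1 : ℤ)⟧) ((HomologicalComplex.single X.Modules (ComplexShape.up ℤ) 0).obj (unitModule X)) ≅
      (homComplex X E ((HomologicalComplex.single X.Modules (ComplexShape.up ℤ) 0).obj (unitModule X)))⟦(-1 : ℤ)⟧ :=
  dualComplexUnitShiftIso X E 1

end Literature.AlgebraicGeometry.HodgeTheory

end
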